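import Literature.NumberTheory.EllipticCurves.IwasawaAlgebraTwoVarGeneratorChange
import Literature.NumberTheory.GaloisRepresentations.AbsGaloisOuterConj
import Literature.NumberTheory.GaloisRepresentations.ArtinFormalismInductionProofs
import Literature.NumberTheory.EllipticCurves.ZpExtensionProofs
import Literature.FieldTheory.Galois.SolvableCompositum
import Literature.NumberTheory.EllipticCurves.HeegnerPoints
import Summits.BirchSwinnertonDyer.BirchSwinnertonDyer.Theorems.PrintCf2SplitBadTwoGeneratorPairSupply
import Summits.BirchSwinnertonDyer.BirchSwinnertonDyer.Theorems.PrintCf2SplitBadTwoSplitPrimeLineSaturationAnyP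
import Literature.NumberTheory.NumberFields.AdicCompletionIntegersPadicIntOfDegreeOne
import HarnessLib

/-!
# The frame involution `A_τ ∈ GL₂(ℤ_p)` of Büyükboduk–Lei's `τ : γ ↦ c γ⁻¹ c⁻¹` in a generator pair of the
# `ℤ_p²`-tower of an imaginary quadratic field (helper on the rational wall `RationalSplitIMCInclusionAtThree`,
# item stmt-BirchSwinnertonDyer-24207, line `ratwall_thin_comb`; cell `pub/bsd-wall`, LEAD `cruxlead-24207` g5;
# `--supports stmt-BirchSwinnertonDyer-24207`)

WHY THIS FILE. The functional-equation stub of the line is, since v6, quantified over a group-like change of frame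
`φ_A = IwasawaAlgebra₂.frameSubst R₀ A`, `A ∈ GL₂(ℤ₃)`; the INTENDED `A` is the matrix `A_τ = frameMatrixOf κ₁ κ₂ γ₁ γ₂ τ`
(`Literature…IwasawaAlgebraTwoVarGeneratorChange`, §8) of the involution `τ : σ ↦ c σ⁻¹ c⁻¹` of `Γ_K` modulo
`Gal(K̄/K̃_∞)`, `c ∈ Γ_ℚ ∖ Γ_K` a complex conjugation. This file PINS `A_τ` in the kernel: for `K` imaginary quadratic,
any generator pair `(κ₁, κ₂; γ₁, γ₂)`, any `c ∈ Γ_ℚ` and any lift `τ : Γ_K → Γ_K` of `g ↦ c g⁻¹ c⁻¹` through the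
restriction `res : Γ_K → Γ_ℚ` (`absGaloisRestrict ℚ K`; such a lift exists and is `σ ↦ θ_c(σ)⁻¹` for the tree's outer
conjugation `θ_c = absGaloisOuterConj ℚ K c`), the characters `κ_i ∘ τ` are `ℤ_p`-combinations of `κ₁, κ₂` (every
continuous `Γ_K → ℤ_p` is: `PrintCf2.GeneratorPairSupply.exists_coeff_of_isTopGeneratorPair_of_isImaginaryQuadratic`,
unit rank `0`), `τ ∘ τ` is inner (`c² ∈ res(Γ_K)`, index two), hence **`A_τ ∈ GL₂(ℤ_p)` with `A_τ · A_τ = 1`**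
(`exists_GL_eq_frameMatrixOf_of_conjInv`). With it the line can quantify its two functional equations over the
PINNED substitution `φ_{A_τ}` — one for the toric two-variable function (Hao–Loeffler 2025 Thm. 4.9), one for the
two-variable Selmer dual (Hao–Lim 2026 main Thm. (c)) — in two SEPARATE stubs, one source each (skeleton v7).

CONTENTS (theorems only; no definition, no instance, no notation, no `sorry`; nothing about elliptic curves):
* §1 (any field `K`, pure `ℤ_p`-linear algebra of a generator pair): `toAdd_apply_of_isTopGeneratorPair` (the four
  coordinates), `frameMatrixOf_eq_of_linear` (`A_τ = M` when `κ_i ∘ τ = Σ_j M_ij κ_j`), `mul_self_eq_one_of_linear_of_involutive`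
  (`M · M = 1` when moreover `κ_i ∘ τ ∘ τ = κ_i`), `exists_GL_eq_frameMatrixOf_of_linear`.
* §2 (`K` imaginary quadratic, `c ∈ Γ_ℚ`, `τ` a lift of `g ↦ c g⁻¹ c⁻¹`): `exists_conjInv` (a lift exists),
  `exists_not_mem_range_absGaloisRestrict_rat` (a `c ∉ res(Γ_K)` exists), `apply_conjInv_conjInv` (`κ (τ (τ σ)) = κ σ` for
  every `ℤ_p`-extension `κ`), `exists_linear_of_conjInv` (the matrix `M`), **`exists_GL_eq_frameMatrixOf_of_conjInv`**.

HONEST FRAMING. Galois bookkeeping only: no functional equation is proved, the off-diagonal entry `A_τ 0 1 ≠ 0` (the frame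
geometry «`c γ₂ c⁻¹` spans the `𝔭`-inertia line») is NOT proved here, and nothing is claimed about `X_Gr` or the toric
two-variable function; BSD is not proved by any of this; 24207 stays OPEN.
References: Neukirch–Schmidt–Wingberg (5.3.5) [cite: NeukirchSchmidtWingberg2008, (5.3.5)]; Washington §13.1–§13.2
[cite: Washington1997, §13.1–§13.2]; Büyükboduk–Lei, arXiv:1707.00557, Def. 3.8 (the involution `τ`) [cite: BuyukbodukLei2017, Def. 3.8];
de Shalit II.4.13 (the unique `ℤ_p²`-extension) [cite: deShalit1987, II.4.13].
-/

set_option linter.dupNamespace false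
set_option autoImplicit false

noncomputable section

open scoped MatrixGroups
open Field Literature.NumberTheory.EllipticCurves Literature.NumberTheory.GaloisRepresentations

namespace Summit.BirchSwinnertonDyer.BirchSwinnertonDyer.Theorems.UniversalToricDescentThinComb.FrameInvolution

/-! ## §1 Generator-pair linear algebra: the frame matrix of a `ℤ_p`-linear, involutive `τ` -/

section Algebra

variable {p : ℕ} [Fact p.Prime] {K : Type*} [Field K] {κ₁ κ₂ : ZpExtension K p}
  {γ₁ γ₂ : absoluteGaloisGroup K} {τ : absoluteGaloisGroup K → absoluteGaloisGroup K}
  {M : Matrix (Fin 2) (Fin 2) ℤ_[p]}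

/-- The four additive coordinates of an adapted generator pair: `κ₁(γ₁) = 1`, `κ₂(γ₁) = 0`, `κ₁(γ₂) = 0`, `κ₂(γ₂) = 1`.
[cite: Washington1997, §13.2] -/
theorem toAdd_apply_of_isTopGeneratorPair (hpair : ZpExtension.IsTopGeneratorPair κ₁ κ₂ γ₁ γ₂) :
    (κ₁ γ₁).toAdd = 1 ∧ (κ₂ γ₁).toAdd = 0 ∧ (κ₁ γ₂).toAdd = 0 ∧ (κ₂ γ₂).toAdd = 1 := by
  refine ⟨?_, ?_, ?_, ?_⟩
  · rw [show κ₁ γ₁ = Multiplicative.ofAdd 1 from hpair.left, toAdd_ofAdd]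
  · rw [hpair.apply_left, toAdd_one]
  · rw [hpair.apply_right, toAdd_one]
  · rw [show κ₂ γ₂ = Multiplicative.ofAdd 1 from hpair.right, toAdd_ofAdd]

/-- **`A_τ = M`**: if `κ₁ ∘ τ = M₀₀ κ₁ + M₀₁ κ₂` and `κ₂ ∘ τ = M₁₀ κ₁ + M₁₁ κ₂` (additively), then the frame matrix of `τ` in
the generator pair `(κ₁, κ₂; γ₁, γ₂)` (entry `(i, j)` = `κ_i(τ γ_j)`) is `M`. [cite: NeukirchSchmidtWingberg2008, (5.3.5)] [cite: Washington1997, §13.2] -/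
theorem frameMatrixOf_eq_of_linear (hpair : ZpExtension.IsTopGeneratorPair κ₁ κ₂ γ₁ γ₂)
    (hM : ∀ σ, (κ₁ (τ σ)).toAdd = M 0 0 * (κ₁ σ).toAdd + M 0 1 * (κ₂ σ).toAdd ∧
      (κ₂ (τ σ)).toAdd = M 1 0 * (κ₁ σ).toAdd + M 1 1 * (κ₂ σ).toAdd) :
    IwasawaAlgebra₂.frameMatrixOf κ₁ κ₂ γ₁ γ₂ τ = M := by
  obtain ⟨h11, h21, h12, h22⟩ := toAdd_apply_of_isTopGeneratorPair hpair
  ext i j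
  fin_cases i <;> fin_cases j
  · simp [IwasawaAlgebra₂.frameMatrixOf, (hM γ₁).1, h11, h21]
  · simp [IwasawaAlgebra₂.frameMatrixOf, (hM γ₂).1, h12, h22]
  · simp [IwasawaAlgebra₂.frameMatrixOf, (hM γ₁).2, h11, h21]
  · simp [IwasawaAlgebra₂.frameMatrixOf, (hM γ₂).2, h12, h22]

/-- **`M · M = 1`** if moreover `κ_i (τ (τ σ)) = κ_i σ` (`τ` is an involution modulo `ker κ₁ ∩ ker κ₂ = Gal(K̄/K̃_∞)`):
expand `κ_i ∘ τ ∘ τ` twice and evaluate at `γ₁`, `γ₂`. [cite: NeukirchSchmidtWingberg2008, (5.3.5)] [cite: Washington1997, §13.2] -/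
theorem mul_self_eq_one_of_linear_of_involutive (hpair : ZpExtension.IsTopGeneratorPair κ₁ κ₂ γ₁ γ₂)
    (hM : ∀ σ, (κ₁ (τ σ)).toAdd = M 0 0 * (κ₁ σ).toAdd + M 0 1 * (κ₂ σ).toAdd ∧
      (κ₂ (τ σ)).toAdd = M 1 0 * (κ₁ σ).toAdd + M 1 1 * (κ₂ σ).toAdd)
    (hinv : ∀ σ, κ₁ (τ (τ σ)) = κ₁ σ ∧ κ₂ (τ (τ σ)) = κ₂ σ) : M * M = 1 := by
  obtain ⟨h11, h21, h12, h22⟩ := toAdd_apply_of_isTopGeneratorPair hpair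
  have r00 : M 0 0 * M 0 0 + M 0 1 * M 1 0 = 1 := by
    have h := (hM (τ γ₁)).1
    rw [(hinv γ₁).1, (hM γ₁).1, (hM γ₁).2, h11, h21] at h
    linear_combination -h
  have r01 : M 0 0 * M 0 1 + M 0 1 * M 1 1 = 0 := by
    have h := (hM (τ γ₂)).1
    rw [(hinv γ₂).1, (hM γ₂).1, (hM γ₂).2, h12, h22] at h
    linear_combination -h
  have r10 : M 1 0 * M 0 0 + M 1 1 * M 1 0 = 0 := by
    have h := (hM (τ γ₁)).2
    rw [(hinv γ₁).2, (hM γ₁).1, (hM γ₁).2, h11, h21] at h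
    linear_combination -h
  have r11 : M 1 0 * M 0 1 + M 1 1 * M 1 1 = 1 := by
    have h := (hM (τ γ₂)).2
    rw [(hinv γ₂).2, (hM γ₂).1, (hM γ₂).2, h12, h22] at h
    linear_combination -h
  ext i j
  fin_cases i <;> fin_cases j <;>
    simp [Matrix.mul_apply, Fin.sum_univ_two, r00, r01, r10, r11]

/-- **`A_τ ∈ GL₂(ℤ_p)`, involutive**: under the linear and involutive hypotheses there is `A ∈ GL₂(ℤ_p)` with
`↑A = frameMatrixOf κ₁ κ₂ γ₁ γ₂ τ` and `A · A = 1`. [cite: NeukirchSchmidtWingberg2008, (5.3.5)] [cite: Washington1997, §13.2] -/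
theorem exists_GL_eq_frameMatrixOf_of_linear (hpair : ZpExtension.IsTopGeneratorPair κ₁ κ₂ γ₁ γ₂)
    (hM : ∀ σ, (κ₁ (τ σ)).toAdd = M 0 0 * (κ₁ σ).toAdd + M 0 1 * (κ₂ σ).toAdd ∧
      (κ₂ (τ σ)).toAdd = M 1 0 * (κ₁ σ).toAdd + M 1 1 * (κ₂ σ).toAdd)
    (hinv : ∀ σ, κ₁ (τ (τ σ)) = κ₁ σ ∧ κ₂ (τ (τ σ)) = κ₂ σ) :
    ∃ A : GL (Fin 2) ℤ_[p], (A : Matrix (Fin 2) (Fin 2) ℤ_[p]) = IwasawaAlgebra₂.frameMatrixOf κ₁ κ₂ γ₁ γ₂ τ ∧ A * A = 1 := by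
  have hMM := mul_self_eq_one_of_linear_of_involutive hpair hM hinv
  exact ⟨⟨M, M, hMM, hMM⟩, (frameMatrixOf_eq_of_linear hpair hM).symm, Units.ext hMM⟩

end Algebra

/-! ## §2 Imaginary quadratic `K`: the involution `σ ↦ c σ⁻¹ c⁻¹` and its frame matrix -/

section ImagQuadratic

variable {p : ℕ} [Fact p.Prime] {K : Type} [Field K] [NumberField K]

/-- **A lift of `g ↦ c g⁻¹ c⁻¹` to `Γ_K` exists** for `[K : ℚ] = 2` (any `c ∈ Γ_ℚ`): `τ σ := θ_c(σ)⁻¹` with the tree's outer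
conjugation `θ_c = absGaloisOuterConj ℚ K c` (`res(Γ_K)` is normal). [cite: Washington1997, §13.1] -/
theorem exists_conjInv (hK2 : Module.finrank ℚ K = 2) (c : absoluteGaloisGroup ℚ) :
    ∃ τ : absoluteGaloisGroup K → absoluteGaloisGroup K,
      ∀ σ, absGaloisRestrict ℚ K (τ σ) = c * (absGaloisRestrict ℚ K σ)⁻¹ * c⁻¹ := by
  haveI : IsGalois ℚ K := Literature.FieldTheory.Galois.isGalois_of_finrank_eq_two hK2
  refine ⟨fun σ ↦ (absGaloisOuterConj ℚ K c σ)⁻¹, fun σ ↦ ?_⟩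
  rw [map_inv, absGaloisRestrict_absGaloisOuterConj]
  group

/-- **Some `c ∈ Γ_ℚ` is not a restriction from `Γ_K`** for `K` imaginary quadratic (a complex conjugation).
[cite: Washington1997, §13.1] -/
theorem exists_not_mem_range_absGaloisRestrict_rat (hK : IsImaginaryQuadratic K) :
    ∃ c : absoluteGaloisGroup ℚ, c ∉ Set.range (absGaloisRestrict ℚ K) := by
  haveI : NumberField.IsTotallyComplex K := hK.2
  obtain ⟨c, hc, -⟩ := exists_not_mem_range_absGaloisRestrict K (Rat.castHom ℝ)
    NumberField.IsTotallyComplex.isComplex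
  exact ⟨c, hc⟩

variable {c : absoluteGaloisGroup ℚ} {τ : absoluteGaloisGroup K → absoluteGaloisGroup K}

/-- A lift `τ` of `g ↦ c g⁻¹ c⁻¹` IS `σ ↦ θ_c(σ)⁻¹` (`res` is injective). [cite: Washington1997, §13.1] -/
theorem conjInv_eq [IsGalois ℚ K] (hτ : ∀ σ, absGaloisRestrict ℚ K (τ σ) = c * (absGaloisRestrict ℚ K σ)⁻¹ * c⁻¹)
    (σ : absoluteGaloisGroup K) : τ σ = (absGaloisOuterConj ℚ K c σ)⁻¹ :=
  absGaloisRestrict_injective ℚ K <| by rw [hτ, map_inv, absGaloisRestrict_absGaloisOuterConj]; group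

/-- **`τ ∘ τ` is inner**: `κ (τ (τ σ)) = κ σ` for every `ℤ_p`-extension `κ` of `K` (indeed for every character of `Γ_K`
with abelian values): `res(τ τ σ) = c² · res(σ) · c⁻²` and `c² ∈ res(Γ_K)` because `res(Γ_K)` has index `[K : ℚ] = 2`.
[cite: Washington1997, §13.1] -/
theorem apply_conjInv_conjInv (hK2 : Module.finrank ℚ K = 2)
    (hτ : ∀ σ, absGaloisRestrict ℚ K (τ σ) = c * (absGaloisRestrict ℚ K σ)⁻¹ * c⁻¹)
    (κ : ZpExtension K p) (σ : absoluteGaloisGroup K) : κ (τ (τ σ)) = κ σ := by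
  haveI : FiniteDimensional ℚ K := Module.finite_of_finrank_eq_succ hK2
  have hidx : (absGaloisRestrict ℚ K).range.index = 2 := by
    rw [index_range_absGaloisRestrict_eq_finrank, hK2]
  obtain ⟨g, hg⟩ : c * c ∈ (absGaloisRestrict ℚ K).range := Subgroup.mul_self_mem_of_index_two hidx c
  have hg' : absGaloisRestrict ℚ K g = c * c := hg
  have hττ : τ (τ σ) = g * σ * g⁻¹ := absGaloisRestrict_injective ℚ K <| by
    rw [hτ, hτ, map_mul, map_mul, map_inv, hg']
    group
  rw [hττ, map_mul, map_mul, map_inv, mul_inv_cancel_comm]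

/-- **The characters `κ_i ∘ τ` are `ℤ_p`-combinations of `κ₁, κ₂`** for `K` imaginary quadratic and any generator pair:
`κ_i ∘ τ = σ ↦ κ_i(θ_c σ)⁻¹` is a continuous homomorphism `Γ_K → ℤ_p`, and every such factors through the pair with
`ℤ_p`-coefficients (unit rank `0`: `exists_coeff_of_isTopGeneratorPair_of_isImaginaryQuadratic`).
[cite: Washington1997, Thm. 13.4] [cite: deShalit1987, II.4.13] -/
theorem exists_linear_of_conjInv (hK : IsImaginaryQuadratic K) {κ₁ κ₂ : ZpExtension K p}
    {γ₁ γ₂ : absoluteGaloisGroup K} (hpair : ZpExtension.IsTopGeneratorPair κ₁ κ₂ γ₁ γ₂)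
    (hτ : ∀ σ, absGaloisRestrict ℚ K (τ σ) = c * (absGaloisRestrict ℚ K σ)⁻¹ * c⁻¹) :
    ∃ M : Matrix (Fin 2) (Fin 2) ℤ_[p], ∀ σ,
      (κ₁ (τ σ)).toAdd = M 0 0 * (κ₁ σ).toAdd + M 0 1 * (κ₂ σ).toAdd ∧
      (κ₂ (τ σ)).toAdd = M 1 0 * (κ₁ σ).toAdd + M 1 1 * (κ₂ σ).toAdd := by
  haveI : IsGalois ℚ K := Literature.FieldTheory.Galois.isGalois_of_finrank_eq_two hK.1
  have key : ∀ σ, τ σ = (absGaloisOuterConj ℚ K c σ)⁻¹ := conjInv_eq hτ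
  -- the two continuous characters `κ_i ∘ τ`
  have mk : ∀ κ : ZpExtension K p, ∃ f : absoluteGaloisGroup K →ₜ* Multiplicative ℤ_[p], ∀ σ, f σ = κ (τ σ) := by
    intro κ
    refine ⟨{ toFun := fun σ ↦ κ (τ σ)
              map_one' := by rw [key, map_one, inv_one, map_one]
              map_mul' := fun σ σ' ↦ by
                rw [key, key, key, map_mul, mul_inv_rev, map_mul, mul_comm]
              continuous_toFun := by
                have : (fun σ ↦ κ (τ σ)) = fun σ ↦ κ ((absGaloisOuterConj ℚ K c σ)⁻¹) := funext fun σ ↦ by rw [key]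
                rw [this]
                exact (map_continuous κ.toContinuousMonoidHom).comp
                  ((absGaloisOuterConj ℚ K c).continuous.inv) }, fun σ ↦ rfl⟩
  obtain ⟨f₁, hf₁⟩ := mk κ₁
  obtain ⟨f₂, hf₂⟩ := mk κ₂
  obtain ⟨a₁, b₁, h₁⟩ := PrintCf2.GeneratorPairSupply.exists_coeff_of_isTopGeneratorPair_of_isImaginaryQuadratic hK hpair f₁
  obtain ⟨a₂, b₂, h₂⟩ := PrintCf2.GeneratorPairSupply.exists_coeff_of_isTopGeneratorPair_of_isImaginaryQuadratic hK hpair f₂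
  refine ⟨!![a₁, b₁; a₂, b₂], fun σ ↦ ⟨?_, ?_⟩⟩
  · rw [← hf₁, h₁]; simp
  · rw [← hf₂, h₂]; simp

/-- **THE FRAME INVOLUTION `A_τ`.** For `K` imaginary quadratic, a generator pair `(κ₁, κ₂; γ₁, γ₂)` of its
`ℤ_p²`-tower, `c ∈ Γ_ℚ` and a lift `τ` of `g ↦ c g⁻¹ c⁻¹`: there is `A ∈ GL₂(ℤ_p)` with
`↑A = IwasawaAlgebra₂.frameMatrixOf κ₁ κ₂ γ₁ γ₂ τ` and `A · A = 1`. (For `c ∉ res(Γ_K)` this is the matrix of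
Büyükboduk–Lei's involution in the frame; for `c ∈ res(Γ_K)` it is `−1`.)
[cite: BuyukbodukLei2017, Def. 3.8] [cite: NeukirchSchmidtWingberg2008, (5.3.5)] [cite: Washington1997, §13.2] -/
theorem exists_GL_eq_frameMatrixOf_of_conjInv (hK : IsImaginaryQuadratic K) {κ₁ κ₂ : ZpExtension K p}
    {γ₁ γ₂ : absoluteGaloisGroup K} (hpair : ZpExtension.IsTopGeneratorPair κ₁ κ₂ γ₁ γ₂)
    (hτ : ∀ σ, absGaloisRestrict ℚ K (τ σ) = c * (absGaloisRestrict ℚ K σ)⁻¹ * c⁻¹) :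
    ∃ A : GL (Fin 2) ℤ_[p],
      (A : Matrix (Fin 2) (Fin 2) ℤ_[p]) = IwasawaAlgebra₂.frameMatrixOf κ₁ κ₂ γ₁ γ₂ τ ∧ A * A = 1 := by
  obtain ⟨M, hM⟩ := exists_linear_of_conjInv hK hpair hτ
  exact exists_GL_eq_frameMatrixOf_of_linear hpair hM
    fun σ ↦ ⟨apply_conjInv_conjInv hK.1 hτ κ₁ σ, apply_conjInv_conjInv hK.1 hτ κ₂ σ⟩

end ImagQuadratic

/-! ## §3 The frame geometry: the off-diagonal entry `A_τ 0 1 ≠ 0` at a SPLIT prime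
(appended 2026-08-29, LEAD `cruxlead-24207` g5 — «Stage C» of LEAD-CENSUS-g5 §1) -/

section OffDiagonal

variable {p : ℕ} [Fact p.Prime] {K : Type} [Field K] [NumberField K]
  {c : absoluteGaloisGroup ℚ} {τ : absoluteGaloisGroup K → absoluteGaloisGroup K}

/-- **THE FRAME GEOMETRY `A_τ 0 1 ≠ 0`.** Let `K` be imaginary quadratic, `(κ₁, κ₂; γ₁, γ₂)` a generator pair of its
`ℤ_p²`-tower with `κ₁` UNRAMIFIED OUTSIDE the place `𝔭` (every inertia group above every `v ≠ 𝔭` lies in `ker κ₁`), where `𝔭 ≠ 𝔭′`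
are two places of `K` above the same rational prime (so that prime SPLITS and the non-trivial automorphism of `K` exchanges them), let
`c ∈ Γ_ℚ ∖ res(Γ_K)` and `τ` a lift of `g ↦ c g⁻¹ c⁻¹`. Then the off-diagonal entry `κ₁(τ γ₂)` of `A_τ = frameMatrixOf κ₁ κ₂ γ₁ γ₂ τ`
is NON-ZERO. Proof: if it vanished, `κ₁ ∘ τ = a·κ₁` (§2) and, `τ ∘ τ` being inner, `κ₁ = a·(κ₁ ∘ τ)`; the character `κ₁ ∘ θ_c`
kills `θ_c⁻¹`… — precisely: for `v ≠ 𝔭′` and `𝔓 ∣ v`, `θ_c(I_𝔓) = I_{c ⋆ 𝔓}` with `c ⋆ 𝔓 ∣ c̄ • v ≠ 𝔭` (`c̄ • v = 𝔭` would force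
`v = c̄⁻¹ • 𝔭 = 𝔭′`), so `κ₁ ∘ θ_c`, hence `κ₁ ∘ τ`, hence `κ₁`, kills `I_𝔓`: `κ₁` would be unramified outside `𝔭` AND outside `𝔭′`,
i.e. everywhere — impossible for a `ℤ_p`-extension of an imaginary quadratic field
(`PrintCf2.SplitPrimeLine.exists_inertia_not_le_kerSubgroup`). This is the side condition `ρ T₂ ∉ (p, T₂)` of the line's weak-reflection
rigidity for `ρ = φ_{A_τ}` (`…GroupLikeReflection.frameSubst_T₂_not_mem`), now a KERNEL FACT.
[cite: Washington1997, §13.1 Prop. 13.2, §13.2] [cite: Brink2007, Cor. 1 (p. 2136)] [cite: NeukirchSchmidtWingberg2008, (5.3.5)] -/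
theorem frameMatrixOf_zero_one_ne_zero (hK : IsImaginaryQuadratic K) {κ₁ κ₂ : ZpExtension K p}
    {γ₁ γ₂ : absoluteGaloisGroup K} (hpair : ZpExtension.IsTopGeneratorPair κ₁ κ₂ γ₁ γ₂)
    {𝔭 𝔭' : IsDedekindDomain.HeightOneSpectrum (NumberField.RingOfIntegers K)}
    (hunder : 𝔭.under (NumberField.RingOfIntegers ℚ) = 𝔭'.under (NumberField.RingOfIntegers ℚ)) (hne : 𝔭' ≠ 𝔭)
    (hur₁ : ∀ v : IsDedekindDomain.HeightOneSpectrum (NumberField.RingOfIntegers K), v ≠ 𝔭 → ∀ 𝔓 ∈ v.primesAbove,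
      𝔓.inertia (absoluteGaloisGroup K) ≤ κ₁.kerSubgroup)
    (hc : c ∉ Set.range (absGaloisRestrict ℚ K))
    (hτ : ∀ σ, absGaloisRestrict ℚ K (τ σ) = c * (absGaloisRestrict ℚ K σ)⁻¹ * c⁻¹) :
    IwasawaAlgebra₂.frameMatrixOf κ₁ κ₂ γ₁ γ₂ τ 0 1 ≠ 0 := by
  haveI : IsGalois ℚ K := Literature.FieldTheory.Galois.isGalois_of_finrank_eq_two hK.1
  intro hb
  -- `κ₁ ∘ τ = a·κ₁` and `κ₁ = a·(κ₁ ∘ τ)`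
  obtain ⟨M, hM⟩ := exists_linear_of_conjInv hK hpair hτ
  have hMeq := frameMatrixOf_eq_of_linear hpair hM
  rw [hMeq] at hb
  have hlin : ∀ σ, (κ₁ (τ σ)).toAdd = M 0 0 * (κ₁ σ).toAdd := fun σ ↦ by
    rw [(hM σ).1, hb, zero_mul, add_zero]
  have hlin' : ∀ σ, (κ₁ σ).toAdd = M 0 0 * (κ₁ (τ σ)).toAdd := fun σ ↦ by
    have h := hlin (τ σ)
    rwa [apply_conjInv_conjInv hK.1 hτ κ₁ σ] at h
  -- the non-trivial automorphism `c̄` of `K` moves `𝔭` to `𝔭′`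
  set cbar : K ≃ₐ[ℚ] K := absGaloisQuot ℚ K c with hcbar_def
  have hcbar_ne : cbar ≠ 1 := fun h ↦ hc <| by
    obtain ⟨x, hx⟩ := (absGaloisQuot_eq_one_iff ℚ K c).mp h
    exact ⟨x, hx⟩
  obtain ⟨σ₀, hσ₀⟩ := Literature.NumberTheory.Automorphic.HeightOneSpectrum.exists_algEquiv_smul_eq ℚ hunder
  have hσ₀ne : σ₀ ≠ 1 := by
    rintro rfl
    exact hne (by rw [← hσ₀, one_smul])
  haveI : FiniteDimensional ℚ K := Module.finite_of_finrank_eq_succ hK.1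
  have hcard : Fintype.card (K ≃ₐ[ℚ] K) ≤ 2 := hK.1 ▸ AlgEquiv.card_le
  have hmove : ∀ σ : K ≃ₐ[ℚ] K, σ ≠ 1 → σ • 𝔭 = 𝔭' := by
    intro σ hσ
    have hσeq : σ = σ₀ := by
      by_contra hne'
      have h3 : 2 < Fintype.card (K ≃ₐ[ℚ] K) := by
        rw [← Finset.card_univ]
        exact Finset.two_lt_card_iff.mpr
          ⟨1, σ, σ₀, Finset.mem_univ _, Finset.mem_univ _, Finset.mem_univ _, hσ.symm, hσ₀ne.symm, hne'⟩
      omega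
    rw [hσeq, hσ₀]
  -- `κ₁` kills the inertia above every `v ≠ 𝔭′`
  have hur₂ : ∀ v : IsDedekindDomain.HeightOneSpectrum (NumberField.RingOfIntegers K), v ≠ 𝔭' →
      ∀ 𝔓 ∈ v.primesAbove, 𝔓.inertia (absoluteGaloisGroup K) ≤ κ₁.kerSubgroup := by
    intro v hv 𝔓 h𝔓 g hg
    have hθg : absGaloisOuterConj ℚ K c g ∈ (outerConjIdeal c 𝔓).inertia (absoluteGaloisGroup K) :=
      (absGaloisOuterConj_mem_inertia_iff c 𝔓 g).mpr hg
    have h𝔓' : outerConjIdeal c 𝔓 ∈ (cbar • v).primesAbove := outerConjIdeal_mem_primesAbove h𝔓 c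
    have hv𝔭 : cbar • v ≠ 𝔭 := fun h ↦ hv <| by
      rw [eq_inv_smul_iff.mpr h]
      exact hmove _ (inv_ne_one.mpr hcbar_ne)
    have h1 : κ₁ (absGaloisOuterConj ℚ K c g) = 1 :=
      ZpExtension.mem_kerSubgroup.mp (hur₁ (cbar • v) hv𝔭 _ h𝔓' hθg)
    have h2 : κ₁ (τ g) = 1 := by rw [conjInv_eq hτ, map_inv, h1, inv_one]
    have h3 := hlin' g
    rw [h2, toAdd_one, mul_zero] at h3
    exact ZpExtension.mem_kerSubgroup.mpr (Multiplicative.toAdd.injective (h3.trans toAdd_one.symm))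
  -- so `κ₁` would be unramified everywhere
  obtain ⟨w, 𝔓, h𝔓, hnot⟩ := PrintCf2.SplitPrimeLine.exists_inertia_not_le_kerSubgroup hK κ₁
  by_cases hw : w = 𝔭
  · exact hnot (hur₂ w (by rw [hw]; exact hne.symm) 𝔓 h𝔓)
  · exact hnot (hur₁ w hw 𝔓 h𝔓)

/-- **The frame geometry at a split `p`, in the line's hypotheses**: `p ∈ 𝔭`, `p ∈ 𝔭′`, `𝔭′ ≠ 𝔭` (two places above the
rational prime `p`, which therefore splits in the quadratic field `K`), `κ₁` unramified outside `𝔭`, `c ∉ res(Γ_K)`, `τ` a lift of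
`g ↦ c g⁻¹ c⁻¹` ⟹ `(frameMatrixOf κ₁ κ₂ γ₁ γ₂ τ) 0 1 ≠ 0`; hence for `A ∈ GL₂(ℤ_p)` with `↑A = frameMatrixOf …` (§2) the substitution
`φ_A` is a WEAK REFLECTION of the line (`φ_A T₂ ∉ (p, T₂)`, `…GroupLikeReflection.frameSubst_T₂_not_mem`).
[cite: Washington1997, §13.1 Prop. 13.2, §13.2] [cite: NeukirchSchmidtWingberg2008, (5.3.5)] -/
theorem frameMatrixOf_zero_one_ne_zero_of_natCast_mem (hK : IsImaginaryQuadratic K) {κ₁ κ₂ : ZpExtension K p}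
    {γ₁ γ₂ : absoluteGaloisGroup K} (hpair : ZpExtension.IsTopGeneratorPair κ₁ κ₂ γ₁ γ₂)
    {𝔭 𝔭' : IsDedekindDomain.HeightOneSpectrum (NumberField.RingOfIntegers K)}
    (h𝔭 : ((p : ℕ) : NumberField.RingOfIntegers K) ∈ 𝔭.asIdeal) (h𝔭' : ((p : ℕ) : NumberField.RingOfIntegers K) ∈ 𝔭'.asIdeal)
    (hne : 𝔭' ≠ 𝔭)
    (hur₁ : ∀ v : IsDedekindDomain.HeightOneSpectrum (NumberField.RingOfIntegers K), v ≠ 𝔭 → ∀ 𝔓 ∈ v.primesAbove,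
      𝔓.inertia (absoluteGaloisGroup K) ≤ κ₁.kerSubgroup)
    (hc : c ∉ Set.range (absGaloisRestrict ℚ K))
    (hτ : ∀ σ, absGaloisRestrict ℚ K (τ σ) = c * (absGaloisRestrict ℚ K σ)⁻¹ * c⁻¹)
    {A : GL (Fin 2) ℤ_[p]} (hA : (A : Matrix (Fin 2) (Fin 2) ℤ_[p]) = IwasawaAlgebra₂.frameMatrixOf κ₁ κ₂ γ₁ γ₂ τ) :
    (A : Matrix (Fin 2) (Fin 2) ℤ_[p]) 0 1 ≠ 0 := by
  rw [hA]
  exact frameMatrixOf_zero_one_ne_zero hK hpair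
    (Literature.NumberTheory.NumberFields.under_eq_under_of_natCast_mem K h𝔭 h𝔭') hne hur₁ hc hτ

end OffDiagonal

end Summit.BirchSwinnertonDyer.BirchSwinnertonDyer.Theorems.UniversalToricDescentThinComb.FrameInvolution

end
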